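import Summits.QuantumFields.YangMills.Theorems.VirialFluxGapChebyshevGamma
import Summits.QuantumFields.YangMills.Theorems.SwapVirialDeficitZeroModeGroupThreeSmallBallRate
import HarnessLib

/-!
# Abelian side of the small-ball ↔ Laplace dictionary, with a POWER RATE and REAL exponent
# (free-hands support of ⟨stmt-QuantumFields-24197⟩: turns the cell's small-ball laws `μ{G ≤ s} = v·s^α(1 + O(s^θ))` — LEAD g93's shape, landed
# for the `k = 3` block by fcl-p3 g44 and (limit form) for the σ-twisted block by w3 g63 — into Laplace asymptotics `β^α·∫e^{−βG}dμ = v·Γ(α+1) + O(β^{−θ})`,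
# the currency of ✓`SharpSigma.swapGluedStiffness_of_sharpSwapLaplace`)

The classical Abelian theorem for Laplace transforms at the origin, quantitative and for a real exponent `α > 0` (the zero-mode blocks have
`α = 2, 7/2, …`; ✓`SharpSigma.tauber_sandwich_rpow_layerCake` of fcl-p3 g43 is the LOG-form, integer-`N`, windowed sandwich):
* §1 ★ `lintegral_exp_neg_mul_eq_layerCake` — `∫ e^{−βG} dμ = ∫_{s>0} μ{G ≤ s}·βe^{−βs} ds` (finite measure, measurable `G ≥ 0`, `β > 0`);
  its real form `integral_exp_neg_mul_eq_layerCake`;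
* §2 ★★★ `laplace_abelian_rate` — if `|μ{G ≤ s} − v·s^α| ≤ K·s^{α+θ}` for `0 < s ≤ 1`, then for every `β ≥ 1`
  `|β^α·∫e^{−βG}dμ − v·Γ(α+1)| ≤ (K + μ(Ω) + v)·Γ(α+θ+1)·β^{−θ}` (the large-`s` part of the layer cake is absorbed by the same Gamma moment);
* §3 ★★★ `laplace_maxCommutator_three_rate` — instantiation on fcl-p3 g44's ✓`abs_haar_tripleBall_div_sub_le_unconditional` (`k = 3` small ball,
  rate `t^{1/19}`): `|β²·∫_{SU(2)³} e^{−β·max_{μ<ν}‖[q_μ,q_ν]‖²} dHaar³ − 2v₃′| ≤ K·β^{−1/38}` — the small-ball constant `v₃′` reappears as `v₃′·Γ(3)`.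
HONEST LABEL: pure real analysis / measure theory (plan-level glue for the zero-mode rung of a DRAFT line «sharp-sigma»); NOT the fixed-`L` sharp law, NOT
⟨24197⟩; the Yang–Mills mass gap is NOT proved; no summit is proved by a line.  Width seat ym-line-sfw-p2-w2 g56 (cell ym-idea-1, free hands; own crux ⟨22884⟩
blocked-on ⟨19935⟩), `--supports stmt-QuantumFields-24197`.  THEOREMS ONLY, standard axioms, 0 `sorry`.  References: [folklore] (Feller, XIII.5; Bingham–Goldie–Teugels §1.7).
-/

set_option autoImplicit false

noncomputable section

open MeasureTheory Set Real Filter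
open scoped ENNReal Topology
open Summit.QuantumFields.YangMills.Theorems.VirialFluxGap.ChebyshevGamma (integral_rpow_mul_exp_neg_mul_Ioi' integrableOn_rpow_mul_exp_neg_mul)

namespace Summit.QuantumFields.YangMills.Theorems.SwapVirialDeficit.Abelian

variable {Ω : Type*} [MeasurableSpace Ω]

/-! ## §1 The layer cake for the Laplace transform -/

/-- `∫_{(g,∞)} βe^{−βt} dt = e^{−βg}` (`β > 0`), as a lower integral. [folklore] -/
theorem lintegral_Ioi_exp_density {β : ℝ} (hβ : 0 < β) (g : ℝ) :
    ∫⁻ t in Ioi g, ENNReal.ofReal (β * Real.exp (-(β * t))) = ENNReal.ofReal (Real.exp (-(β * g))) := by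
  have hint : IntegrableOn (fun t : ℝ => β * Real.exp (-(β * t))) (Ioi g) := by
    have h := (exp_neg_integrableOn_Ioi g hβ).const_mul β
    simp only [neg_mul] at h
    exact h
  rw [← ofReal_integral_eq_lintegral_ofReal hint (ae_of_all _ fun t => by positivity)]
  congr 1
  have e : (fun t : ℝ => β * Real.exp (-(β * t))) = fun t => β * Real.exp (-β * t) := by funext t; ring_nf
  rw [e, integral_const_mul, integral_exp_mul_Ioi (by linarith : -β < 0)]
  field_simp

/-- For `g ≥ 0`: `∫_{(0,∞)} 𝟙{g ≤ t}·βe^{−βt} dt = e^{−βg}`. [folklore] -/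
theorem lintegral_Ioi_indicator_exp_density {β : ℝ} (hβ : 0 < β) {g : ℝ} (hg : 0 ≤ g) :
    ∫⁻ t in Ioi (0:ℝ), (Ici g).indicator (fun t => ENNReal.ofReal (β * Real.exp (-(β * t)))) t = ENNReal.ofReal (Real.exp (-(β * g))) := by
  rw [lintegral_indicator measurableSet_Ici, Measure.restrict_restrict measurableSet_Ici]
  have hset : (Ici g ∩ Ioi (0:ℝ) : Set ℝ) =ᵐ[volume] (Ioi g : Set ℝ) := by
    rcases hg.eq_or_lt with h | h
    · have e : Ici g ∩ Ioi (0:ℝ) = Ioi g := by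
        ext t; simp only [mem_inter_iff, mem_Ici, mem_Ioi, ← h]; constructor
        · exact fun ht => ht.2
        · exact fun ht => ⟨le_of_lt ht, ht⟩
      rw [e]
    · have e : Ici g ∩ Ioi (0:ℝ) = Ici g := by
        ext t; simp only [mem_inter_iff, mem_Ici, mem_Ioi]; constructor
        · exact fun ht => ht.1
        · exact fun ht => ⟨ht, lt_of_lt_of_le h ht⟩
      rw [e]; exact Ioi_ae_eq_Ici.symm
  rw [setLIntegral_congr hset, lintegral_Ioi_exp_density hβ g]

/-- ★ **LAYER CAKE FOR THE LAPLACE TRANSFORM**: for a finite measure, a measurable `G ≥ 0` and `β > 0`,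
`∫ e^{−βG} dμ = ∫_{(0,∞)} μ{G ≤ s}·βe^{−βs} ds` (lower integrals). [folklore] -/
theorem lintegral_exp_neg_mul_eq_layerCake (μ : Measure Ω) [IsFiniteMeasure μ] {G : Ω → ℝ} (hG : Measurable G) (hG0 : ∀ ω, 0 ≤ G ω)
    {β : ℝ} (hβ : 0 < β) :
    ∫⁻ ω, ENNReal.ofReal (Real.exp (-(β * G ω))) ∂μ =
      ∫⁻ s in Ioi (0:ℝ), μ {ω | G ω ≤ s} * ENNReal.ofReal (β * Real.exp (-(β * s))) := by
  -- pointwise layer cake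
  have hpt : ∀ ω, ENNReal.ofReal (Real.exp (-(β * G ω))) =
      ∫⁻ t in Ioi (0:ℝ), (Ici (G ω)).indicator (fun t => ENNReal.ofReal (β * Real.exp (-(β * t)))) t := fun ω =>
    (lintegral_Ioi_indicator_exp_density hβ (hG0 ω)).symm
  simp_rw [hpt]
  -- Tonelli
  have hF : Measurable (Function.uncurry fun (ω : Ω) (t : ℝ) => (Ici (G ω)).indicator (fun t => ENNReal.ofReal (β * Real.exp (-(β * t)))) t) := by
    have e : (Function.uncurry fun (ω : Ω) (t : ℝ) => (Ici (G ω)).indicator (fun t => ENNReal.ofReal (β * Real.exp (-(β * t)))) t) =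
        fun p : Ω × ℝ => {p : Ω × ℝ | G p.1 ≤ p.2}.indicator (fun p => ENNReal.ofReal (β * Real.exp (-(β * p.2)))) p := by
      funext p
      simp only [Function.uncurry, Set.indicator_apply, mem_Ici, mem_setOf_eq]
    rw [e]
    exact (ENNReal.measurable_ofReal.comp (by fun_prop)).indicator (measurableSet_le (hG.comp measurable_fst) measurable_snd)
  rw [lintegral_lintegral_swap hF.aemeasurable]
  refine lintegral_congr fun t => ?_
  have e2 : ∀ ω, (Ici (G ω)).indicator (fun t => ENNReal.ofReal (β * Real.exp (-(β * t)))) t =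
      {ω | G ω ≤ t}.indicator (fun _ => ENNReal.ofReal (β * Real.exp (-(β * t)))) ω := by
    intro ω; simp only [Set.indicator_apply, mem_Ici, mem_setOf_eq]
  simp_rw [e2]
  rw [lintegral_indicator_const (measurableSet_le hG measurable_const), mul_comm]

/-- The distribution function `s ↦ μ{G ≤ s}` is measurable (monotone). [folklore] -/
theorem measurable_measure_le (μ : Measure Ω) (G : Ω → ℝ) : Measurable fun s : ℝ => μ {ω | G ω ≤ s} :=
  Monotone.measurable fun _ _ h => measure_mono fun _ hω => le_trans hω h

/-- ★ Real form of the layer cake: `∫ e^{−βG} dμ = ∫_{(0,∞)} (μ{G ≤ s}).toReal·βe^{−βs} ds`. [folklore] -/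
theorem integral_exp_neg_mul_eq_layerCake (μ : Measure Ω) [IsFiniteMeasure μ] {G : Ω → ℝ} (hG : Measurable G) (hG0 : ∀ ω, 0 ≤ G ω)
    {β : ℝ} (hβ : 0 < β) :
    ∫ ω, Real.exp (-(β * G ω)) ∂μ = ∫ s in Ioi (0:ℝ), (μ {ω | G ω ≤ s}).toReal * (β * Real.exp (-(β * s))) := by
  have hint : Integrable (fun ω => Real.exp (-(β * G ω))) μ := by
    refine Integrable.of_bound (C := 1) (by fun_prop : Measurable fun ω => Real.exp (-(β * G ω))).aestronglyMeasurable
      (ae_of_all _ fun ω => ?_)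
    rw [Real.norm_eq_abs, abs_of_pos (Real.exp_pos _)]
    exact Real.exp_le_one_iff.2 (by nlinarith [hG0 ω])
  have h1 := lintegral_exp_neg_mul_eq_layerCake μ hG hG0 hβ
  rw [← ofReal_integral_eq_lintegral_ofReal hint (ae_of_all _ fun ω => (Real.exp_pos _).le)] at h1
  -- the right-hand side as an `ofReal`
  have hdens : IntegrableOn (fun s : ℝ => (μ {ω | G ω ≤ s}).toReal * (β * Real.exp (-(β * s)))) (Ioi 0) := by
    have hb : IntegrableOn (fun s : ℝ => (μ univ).toReal * (β * Real.exp (-(β * s)))) (Ioi 0) := by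
      have h := ((exp_neg_integrableOn_Ioi 0 hβ).const_mul β).const_mul (μ univ).toReal
      simp only [neg_mul] at h
      exact h
    refine hb.mono' (((ENNReal.measurable_toReal.comp (measurable_measure_le μ G)).mul (by fun_prop)).aestronglyMeasurable)
      (ae_of_all _ fun s => ?_)
    rw [Real.norm_eq_abs, abs_of_nonneg (by positivity)]
    exact mul_le_mul_of_nonneg_right (ENNReal.toReal_mono (measure_ne_top μ _) (measure_mono (subset_univ _))) (by positivity)
  have h2 : ∫⁻ s in Ioi (0:ℝ), μ {ω | G ω ≤ s} * ENNReal.ofReal (β * Real.exp (-(β * s))) =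
      ENNReal.ofReal (∫ s in Ioi (0:ℝ), (μ {ω | G ω ≤ s}).toReal * (β * Real.exp (-(β * s)))) := by
    rw [ofReal_integral_eq_lintegral_ofReal hdens (ae_of_all _ fun s => by positivity)]
    refine lintegral_congr fun s => ?_
    rw [ENNReal.ofReal_mul ENNReal.toReal_nonneg, ENNReal.ofReal_toReal (measure_ne_top μ _)]
  rw [h2] at h1
  have hI0 : 0 ≤ ∫ ω, Real.exp (-(β * G ω)) ∂μ := integral_nonneg fun ω => (Real.exp_pos _).le
  have hJ0 : 0 ≤ ∫ s in Ioi (0:ℝ), (μ {ω | G ω ≤ s}).toReal * (β * Real.exp (-(β * s))) :=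
    setIntegral_nonneg measurableSet_Ioi fun s _ => by positivity
  exact (ENNReal.ofReal_eq_ofReal_iff hI0 hJ0).1 h1

/-! ## §2 The Abelian theorem with a power rate -/

/-- ★★★ **ABELIAN THEOREM WITH A POWER RATE, REAL EXPONENT**: for a finite measure `μ`, a measurable `G ≥ 0`, `α > 0`, `θ > 0`, `v, K ≥ 0`
with the small-ball law `|μ{G ≤ s} − v·s^α| ≤ K·s^{α+θ}` for `0 < s ≤ 1`, and every `β ≥ 1`:
`|β^α·∫e^{−βG}dμ − v·Γ(α+1)| ≤ (K + μ(Ω) + v)·Γ(α+θ+1)·β^{−θ}`. [folklore] -/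
theorem laplace_abelian_rate (μ : Measure Ω) [IsFiniteMeasure μ] {G : Ω → ℝ} (hG : Measurable G) (hG0 : ∀ ω, 0 ≤ G ω)
    {α θ v K : ℝ} (hα : 0 < α) (hθ : 0 < θ) (hv : 0 ≤ v) (hK : 0 ≤ K)
    (hm : ∀ s : ℝ, 0 < s → s ≤ 1 → |(μ {ω | G ω ≤ s}).toReal - v * s ^ α| ≤ K * s ^ (α + θ)) {β : ℝ} (hβ : 1 ≤ β) :
    |β ^ α * ∫ ω, Real.exp (-(β * G ω)) ∂μ - v * Real.Gamma (α + 1)| ≤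
      (K + (μ univ).toReal + v) * Real.Gamma (α + θ + 1) * β ^ (-θ) := by
  have hβ0 : 0 < β := by linarith
  set M : ℝ := (μ univ).toReal with hM
  have hM0 : 0 ≤ M := ENNReal.toReal_nonneg
  set m : ℝ → ℝ := fun s => (μ {ω | G ω ≤ s}).toReal with hm_def
  have hm0 : ∀ s, 0 ≤ m s := fun s => ENNReal.toReal_nonneg
  have hmM : ∀ s, m s ≤ M := fun s => ENNReal.toReal_mono (measure_ne_top μ _) (measure_mono (subset_univ _))
  have hmeas : Measurable m := ENNReal.measurable_toReal.comp (measurable_measure_le μ G)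
  -- the two Gamma moments
  have hΓ1 : ∫ s in Ioi (0:ℝ), s ^ α * Real.exp (-(β * s)) = Real.Gamma (α + 1) / β ^ (α + 1) :=
    integral_rpow_mul_exp_neg_mul_Ioi' (by linarith) hβ0
  have hΓ2 : ∫ s in Ioi (0:ℝ), s ^ (α + θ) * Real.exp (-(β * s)) = Real.Gamma (α + θ + 1) / β ^ (α + θ + 1) :=
    integral_rpow_mul_exp_neg_mul_Ioi' (by linarith) hβ0
  have hI1 : IntegrableOn (fun s : ℝ => s ^ α * Real.exp (-(β * s))) (Ioi 0) := integrableOn_rpow_mul_exp_neg_mul (by linarith) hβ0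
  have hI2 : IntegrableOn (fun s : ℝ => s ^ (α + θ) * Real.exp (-(β * s))) (Ioi 0) := integrableOn_rpow_mul_exp_neg_mul (by linarith) hβ0
  -- the layer cake and the model term
  have hL : β ^ α * ∫ ω, Real.exp (-(β * G ω)) ∂μ = ∫ s in Ioi (0:ℝ), m s * (β ^ (α + 1) * Real.exp (-(β * s))) := by
    rw [integral_exp_neg_mul_eq_layerCake μ hG hG0 hβ0, ← integral_const_mul]
    refine setIntegral_congr_fun measurableSet_Ioi fun s _ => ?_
    simp only [hm_def]
    rw [Real.rpow_add hβ0, Real.rpow_one]; ring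
  have hV : v * Real.Gamma (α + 1) = ∫ s in Ioi (0:ℝ), v * s ^ α * (β ^ (α + 1) * Real.exp (-(β * s))) := by
    have e : (fun s : ℝ => v * s ^ α * (β ^ (α + 1) * Real.exp (-(β * s)))) = fun s => (v * β ^ (α + 1)) * (s ^ α * Real.exp (-(β * s))) := by
      funext s; ring
    rw [e, integral_const_mul, hΓ1]
    have hb : 0 < β ^ (α + 1) := Real.rpow_pos_of_pos hβ0 _
    field_simp
  -- integrability of the two pieces
  have hIm : IntegrableOn (fun s : ℝ => m s * (β ^ (α + 1) * Real.exp (-(β * s)))) (Ioi 0) := by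
    have hb : IntegrableOn (fun s : ℝ => M * (β ^ (α + 1) * Real.exp (-(β * s)))) (Ioi 0) := by
      have h := ((exp_neg_integrableOn_Ioi 0 hβ0).const_mul (β ^ (α + 1))).const_mul M
      simp only [neg_mul] at h
      exact h
    refine hb.mono' ((hmeas.mul (by fun_prop)).aestronglyMeasurable) (ae_of_all _ fun s => ?_)
    rw [Real.norm_eq_abs, abs_of_nonneg (mul_nonneg (hm0 s) (by positivity))]
    exact mul_le_mul_of_nonneg_right (hmM s) (by positivity)
  have hIv : IntegrableOn (fun s : ℝ => v * s ^ α * (β ^ (α + 1) * Real.exp (-(β * s)))) (Ioi 0) := by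
    have e : (fun s : ℝ => v * s ^ α * (β ^ (α + 1) * Real.exp (-(β * s)))) = fun s => (v * β ^ (α + 1)) * (s ^ α * Real.exp (-(β * s))) := by
      funext s; ring
    rw [e]
    exact hI1.const_mul (v * β ^ (α + 1))
  -- the difference as one integral, dominated by the Gamma moment of order `α + θ`
  rw [hL, hV, ← integral_sub hIm hIv]
  have hdom : ∀ s ∈ Ioi (0:ℝ), ‖m s * (β ^ (α + 1) * Real.exp (-(β * s))) - v * s ^ α * (β ^ (α + 1) * Real.exp (-(β * s)))‖ ≤
      (K + M + v) * β ^ (α + 1) * (s ^ (α + θ) * Real.exp (-(β * s))) := by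
    intro s hs
    have hs0 : 0 < s := hs
    have hw : 0 ≤ β ^ (α + 1) * Real.exp (-(β * s)) := by positivity
    rw [Real.norm_eq_abs, show m s * (β ^ (α + 1) * Real.exp (-(β * s))) - v * s ^ α * (β ^ (α + 1) * Real.exp (-(β * s))) =
      (m s - v * s ^ α) * (β ^ (α + 1) * Real.exp (-(β * s))) by ring, abs_mul, abs_of_nonneg hw]
    have key : |m s - v * s ^ α| ≤ (K + M + v) * s ^ (α + θ) := by
      rcases le_or_gt s 1 with h1 | h1
      · calc |m s - v * s ^ α| ≤ K * s ^ (α + θ) := hm s hs0 h1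
          _ ≤ (K + M + v) * s ^ (α + θ) := mul_le_mul_of_nonneg_right (by linarith) (Real.rpow_nonneg hs0.le _)
      · have hsa : s ^ α ≤ s ^ (α + θ) := Real.rpow_le_rpow_of_exponent_le h1.le (by linarith)
        have hs1 : (1:ℝ) ≤ s ^ (α + θ) := Real.one_le_rpow h1.le (by linarith)
        calc |m s - v * s ^ α| ≤ |m s| + |v * s ^ α| := abs_sub _ _
          _ = m s + v * s ^ α := by rw [abs_of_nonneg (hm0 s), abs_of_nonneg (by positivity)]
          _ ≤ M * s ^ (α + θ) + v * s ^ (α + θ) := add_le_add (by nlinarith [hmM s, hm0 s]) (mul_le_mul_of_nonneg_left hsa hv)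
          _ ≤ (K + M + v) * s ^ (α + θ) := by nlinarith [Real.rpow_nonneg hs0.le (α + θ)]
    calc |m s - v * s ^ α| * (β ^ (α + 1) * Real.exp (-(β * s))) ≤ (K + M + v) * s ^ (α + θ) * (β ^ (α + 1) * Real.exp (-(β * s))) :=
          mul_le_mul_of_nonneg_right key hw
      _ = (K + M + v) * β ^ (α + 1) * (s ^ (α + θ) * Real.exp (-(β * s))) := by ring
  have hbound := norm_integral_le_of_norm_le (hI2.const_mul ((K + M + v) * β ^ (α + 1)))
    ((ae_restrict_iff' measurableSet_Ioi).2 (ae_of_all _ hdom))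
  rw [Real.norm_eq_abs] at hbound
  refine hbound.trans (le_of_eq ?_)
  rw [integral_const_mul, hΓ2, Real.rpow_neg hβ0.le]
  have hb1 : 0 < β ^ (α + 1) := Real.rpow_pos_of_pos hβ0 _
  have hb2 : β ^ (α + θ + 1) = β ^ (α + 1) * β ^ θ := by rw [← Real.rpow_add hβ0]; ring_nf
  rw [hb2]
  have hb3 : 0 < β ^ θ := Real.rpow_pos_of_pos hβ0 _
  field_simp

/-! ## §3 Instantiation: the `k = 3` max-commutator block in Laplace form, with a rate -/

open Quaternion Literature.MathematicalPhysics.QuantumLattice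
open scoped Quaternion
open Literature.MathematicalPhysics.QuantumFieldTheory (haarProbability)
open Literature.MathematicalPhysics.QuantumFieldTheory.Balaban1983to89.T4HaarSU2Translate (continuous_su2Quat)
open Summit.QuantumFields.YangMills.Theorems.SwapTwistDeficit.ToronLog
open Summit.QuantumFields.YangMills.Theorems.SwapVirialDeficit.ZeroModeGroup

attribute [local instance] Literature.Analysis.FluidPDE.Tao2016.quatMeasurableSpace
  Literature.Analysis.FluidPDE.Tao2016.quatBorelSpace
  Literature.MathematicalPhysics.QuantumLattice.secondCountableTopology_su2

/-- The squared max-commutator `G(C) = (max_{μ<ν} ‖[q_μ,q_ν]‖)²` on `SU(2)³`. [folklore] -/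
def maxCommSq (C : Fin 3 → Matrix.specialUnitaryGroup (Fin 2) ℂ) : ℝ :=
  (max (max ‖su2Quat (C 0) * su2Quat (C 1) - su2Quat (C 1) * su2Quat (C 0)‖ ‖su2Quat (C 0) * su2Quat (C 2) - su2Quat (C 2) * su2Quat (C 0)‖)
    ‖su2Quat (C 1) * su2Quat (C 2) - su2Quat (C 2) * su2Quat (C 1)‖) ^ 2

/-- `maxCommSq` is measurable. [folklore] -/
theorem measurable_maxCommSq : Measurable maxCommSq := by
  have hq : ∀ μ : Fin 3, Continuous fun C : Fin 3 → Matrix.specialUnitaryGroup (Fin 2) ℂ => su2Quat (C μ) :=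
    fun μ => continuous_su2Quat.comp (continuous_apply μ)
  unfold maxCommSq
  exact ((((((hq 0).mul (hq 1)).sub ((hq 1).mul (hq 0))).norm.max (((hq 0).mul (hq 2)).sub ((hq 2).mul (hq 0))).norm).max
    (((hq 1).mul (hq 2)).sub ((hq 2).mul (hq 1))).norm).pow 2).measurable

/-- `maxCommSq ≥ 0`. [folklore] -/
theorem maxCommSq_nonneg (C : Fin 3 → Matrix.specialUnitaryGroup (Fin 2) ℂ) : 0 ≤ maxCommSq C := by unfold maxCommSq; positivity

/-- `{G ≤ s} = N₃(√s)` for `s ≥ 0` (✓`tripleBall`). [folklore] -/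
theorem setOf_maxCommSq_le {s : ℝ} (hs : 0 ≤ s) : {C | maxCommSq C ≤ s} = tripleBall (Real.sqrt s) := by
  ext C
  simp only [mem_setOf_eq, tripleBall, maxCommSq]
  set a := ‖su2Quat (C 0) * su2Quat (C 1) - su2Quat (C 1) * su2Quat (C 0)‖
  set b := ‖su2Quat (C 0) * su2Quat (C 2) - su2Quat (C 2) * su2Quat (C 0)‖
  set c := ‖su2Quat (C 1) * su2Quat (C 2) - su2Quat (C 2) * su2Quat (C 1)‖
  have hm : 0 ≤ max (max a b) c := le_max_of_le_right (norm_nonneg _)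
  rw [← Real.le_sqrt hm hs, max_le_iff, max_le_iff, and_assoc]

/-- ★★★ **THE `k = 3` MAX-COMMUTATOR BLOCK IN LAPLACE FORM, WITH A RATE** (Abelian image of fcl-p3 g44's small-ball rate):
`|β²·∫_{SU(2)³} e^{−β(max_{μ<ν}‖[q_μ,q_ν]‖)²} dHaar³ − v₃′·Γ(3)| ≤ K·β^{−1/38}` for `β ≥ 1`, with `v₃′` THE small-ball constant of
✓`abs_haar_tripleBall_div_sub_le_unconditional`.  HONEST LABEL: plan-level zero-mode rung; NOT ⟨24197⟩; the Yang–Mills mass gap is NOT proved.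
[cite: GonzalezarroyoAltes1988] [cite: Vanbaal2001] -/
theorem laplace_maxCommutator_three_rate :
    ∃ K : ℝ, ∀ β : ℝ, 1 ≤ β →
      |β ^ (2:ℝ) * (∫ C, Real.exp (-(β * maxCommSq C)) ∂(Measure.pi fun _ : Fin 3 => haarProbability (Matrix.specialUnitaryGroup (Fin 2) ℂ))) -
        (ENNReal.ofReal coneConst * (ENNReal.ofReal coneConst *
          ∫⁻ a, (∫⁻ x, ∫⁻ y, (rescaledSet 0 (axisPoint a)).indicator (1 : ℍ × ℍ → ℝ≥0∞) (x, y)) ∂coneMeasure)).toReal * Real.Gamma (2 + 1)| ≤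
        K * β ^ (-(1/38 : ℝ)) := by
  set μ3 := Measure.pi fun _ : Fin 3 => haarProbability (Matrix.specialUnitaryGroup (Fin 2) ℂ) with hμ3
  set v : ℝ := (ENNReal.ofReal coneConst * (ENNReal.ofReal coneConst *
    ∫⁻ a, (∫⁻ x, ∫⁻ y, (rescaledSet 0 (axisPoint a)).indicator (1 : ℍ × ℍ → ℝ≥0∞) (x, y)) ∂coneMeasure)).toReal with hv_def
  have hv : 0 ≤ v := ENNReal.toReal_nonneg
  obtain ⟨K, hK⟩ := abs_haar_tripleBall_div_sub_le_unconditional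
  -- the constant may be taken nonnegative
  have hK1 : 0 ≤ K := by
    have h := hK 1 one_pos le_rfl
    rw [Real.one_rpow, mul_one] at h
    exact (abs_nonneg _).trans h
  -- the small-ball law in the form of §2: `|m(s) − v s²| ≤ K s^{2 + 1/38}` on `(0,1]`
  have hm : ∀ s : ℝ, 0 < s → s ≤ 1 → |(μ3 {C | maxCommSq C ≤ s}).toReal - v * s ^ (2:ℝ)| ≤ K * s ^ ((2:ℝ) + 1/38) := by
    intro s hs hs1
    have ht : 0 < Real.sqrt s := Real.sqrt_pos.2 hs
    have ht1 : Real.sqrt s ≤ 1 := Real.sqrt_le_one.mpr hs1 |>.trans_eq' rfl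
    have h := hK (Real.sqrt s) ht ht1
    rw [setOf_maxCommSq_le hs.le]
    have hs4 : Real.sqrt s ^ 4 = s ^ (2:ℝ) := by
      rw [show (4:ℕ) = 2 * 2 from rfl, pow_mul, Real.sq_sqrt hs.le, Real.rpow_two]
    have hsθ : Real.sqrt s ^ ((1:ℝ) / 19) = s ^ ((1:ℝ) / 38) := by
      rw [Real.sqrt_eq_rpow, ← Real.rpow_mul hs.le]; norm_num
    rw [hs4, hsθ] at h
    have hs2 : 0 < s ^ (2:ℝ) := Real.rpow_pos_of_pos hs _
    have h2 := mul_le_mul_of_nonneg_right h hs2.le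
    rw [← abs_of_pos hs2, ← abs_mul, abs_of_pos hs2] at h2
    have e1 : ((μ3 (tripleBall (Real.sqrt s))).toReal / s ^ (2:ℝ) - v) * s ^ (2:ℝ) = (μ3 (tripleBall (Real.sqrt s))).toReal - v * s ^ (2:ℝ) := by
      field_simp
    have e2 : K * s ^ ((1:ℝ) / 38) * s ^ (2:ℝ) = K * s ^ ((2:ℝ) + 1/38) := by
      rw [Real.rpow_add hs]; ring
    rwa [e1, e2] at h2
  refine ⟨(K + (μ3 univ).toReal + v) * Real.Gamma (2 + 1/38 + 1), ?_⟩
  intro β hβ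
  exact laplace_abelian_rate μ3 measurable_maxCommSq maxCommSq_nonneg (by norm_num : (0:ℝ) < 2) (by norm_num : (0:ℝ) < 1/38) hv hK1 hm hβ

end Summit.QuantumFields.YangMills.Theorems.SwapVirialDeficit.Abelian

end
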